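import Literature.NumberTheory.LFunctions.RodgersTaoNearbySumsProofs
import Mathlib.Analysis.Normed.Ring.InfiniteSum
import HarnessLib

/-!
# Rodgers–Tao 2020, Lemma 19 — RH-FREE CONTENT twin, Part II: the expansion
# `H̃_T(t) = Σ_{j∼_T k} ψ_T(j)ψ_T(k) H̃_{jk}(t) + o(T log³ T)` on a window above a real-rooted time,
# under the location law (50)

RH-FREE literature proofs (no definitions, no named facts, no `sorry`). Trunk T-ANT
(`Literature/NumberTheory/LFunctions`); companion of `RodgersTaoHamiltonian.lean` (the typed,
VACUOUS-AS-PRINTED / EX-FALSO fact `Literature.NumberTheory.LFunctions.rodgers_tao_truncHamiltonian_expansion`,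
Rodgers–Tao 2020 Lemma 19 = arXiv v4 Lemma 7.4, FMP p. 44) and PART II of its CONTENT twin:
Part I (`RodgersTaoNearbySumsProofs.lean`) proved the `t`-free cancellation of the nearby row sums
`S_j(T) = Σ_{k : j∼_T k} ψ_T(k)/(ξ_j − ξ_k)`; this file adds the zeros — the location law (50) in
the hypothesis shape H1/H2 of the cell's P5.1/P6.1 twins (`RodgersTaoGapBoundProofs.lean`,
`rodgers_tao_gap_bound_of`) — and assembles the expansion. C3 cell, CONTENT-TWIN programme
(rt-lead standing ruling: content twins are 0-fact new modules).

> B. Rodgers, T. Tao, *The de Bruijn–Newman constant is non-negative*, Forum Math. Pi 8 (2020)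
> e6 (= arXiv:1801.05914v4 §7), **Lemma 19** (FMP p. 44; v4 Lemma 7.4, TeX l. 1144–1148):
> "For every `Λ/2 ≤ t ≤ 0`, one has
> `H̃_T(t) = Σ_{j,k ∈ ℤ^*: j ∼_T k} ψ_T(j) ψ_T(k) H̃_{jk}(t) + o_{T→∞}(T log^3_+ T)`."
> Proof (p. 44): "From (71) one has `H̃_{jk}(t) = H_{jk}(t) − log(1/|ξ_j−ξ_k|) −
> ((x_j(t)−ξ_j) − (x_k(t)−ξ_k))/(ξ_j−ξ_k)` so by (69) it suffices to show that
> `Σ_{j∼_T k} ψ_T(j)ψ_T(k)((x_j(t)−ξ_j) − (x_k(t)−ξ_k))/(ξ_j−ξ_k) = o_{T→∞}(T log³₊ T)`. Note from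
> (43), (50), (45), (66) that the sum here is absolutely convergent. Desymmetrizing, it suffices
> to show that `Σ_j ψ_T(j)|x_j(t) − ξ_j| |Σ_{k: j∼_T k} ψ_T(k)/(ξ_j−ξ_k)| = o_{T→∞}(T log³ T)`. …"

## Main results (all `theorem`s, 0 new facts)

* `abs_deBruijnZeroZ_sub_classicalLocationZ_le` — the location law (50) on all of `ℤ` from its
  `ℕ`-indexed form (oddness);
* `exists_renormHamiltonianZ_poly_bound` — on a window `[t₁,t₂]` above a real-rooted `t₀ < t₁` and
  under (50): `|x_j − ξ_j|/|ξ_j − ξ_k|`, `|D_{jk}|` and `0 ≤ H̃_{jk} ≤ K(2+|j|)³(2+|k|)³` uniformly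
  in `t` («the sum here is absolutely convergent»: inputs Prop. 13 in RH-free form
  `rodgers_tao_gap_bound_of`, (44), (43), the identity (63)/(71));
* `summable_truncWeight_mul_cube` — `Σ_j ψ_T(j)(2+|j|)³ < ∞` (the `ψ_T`-majorant on `ℤ × ℤ`);
* `truncWeight_mul_renormHamiltonianZ_eq` — the identity of p. 44 on a nearby pair, weighted
  (sign-corrected, as the tree's `renormHamiltonianZ_eq_hamiltonianInteraction_sub`);
* `nearby_indicator_factor`, `nearby_indicator_swap` — the desymmetrisation («Desymmetrizing»):
  the second half of `D_{jk}` is minus the first under `(j,k) ↦ (k,j)`;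
* **`rodgers_tao_truncHamiltonian_expansion_of`** — THE SCHEMA: `t₀ < t₁`, `H_{t₀}` real-rooted,
  (50) on `[t₁,t₂]` ⟹ `∀ ε > 0 ∃ T₁ ∀ T ≥ T₁ ∀ t ∈ [t₁,t₂]`, the series (69) and `Σ ψψH̃` are
  summable and `|H̃_T(t) − Σ_{j∼_T k} ψψ H̃_{jk}(t)| ≤ ε T log³ T` (Fubini on `ℤ × ℤ` with the
  majorant, the swap `Equiv.prodComm`, the row sums of Part I, and Part I's
  `nearbyRow_weighted_tsum_le`);
* **`rodgers_tao_truncHamiltonian_expansion_of_cor33_location`** — the AS-PRINTED reduction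
  `RodgersTao2020.cor33_location → rodgers_tao_truncHamiltonian_expansion` (window `[t₀/2, 0]` above
  the witness `t₀ < 0`). No second `_holds` is declared for the (ex-falso discharged) fact.

Divergences from print (statement-level: none): the schema replaces the printed `Λ/2 ≤ t ≤ 0`
(VACUOUS-AS-PRINTED, `Λ ≥ 0` in the tree) by an arbitrary window above a real-rooted time with the
location law as an explicit hypothesis (house form, cell ruling R2 / (42)); the absolute
convergence is obtained from the polynomial majorant `ψ_T(j)ψ_T(k)(2+|j|)³(2+|k|)³` on all of
`ℤ* × ℤ*` rather than from (43), (50), (45), (66) on the nearby pairs only; the `o(T log³ T)`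
carries the explicit rate of Part I.

bears_on: N-C/N-P (COLUMN 3 DBN). WHAT THIS IS NOT: an RH-free identity-plus-estimate for the
zeros of `H_t` on windows where they are real and obey the location law; the printed
`Λ/2 ≤ t ≤ 0` instance is VACUOUS-AS-PRINTED; nothing here bears on the truth of RH.

## References

* B. Rodgers, T. Tao, Forum Math. Pi 8 (2020) e6, §7: Lemma 19 p. 44 and its proof, (69)–(71)
  pp. 43–44; Corollary 10 (50) p. 23; Prop. 13 p. 34; Lemma 8 (44) p. 21 (= arXiv:1801.05914v4
  Lemma 7.4, Cor. 3.3, Prop. 5.1, Lemma 3.1).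
-/

noncomputable section

open Set Filter Topology Finset Real

namespace Literature.NumberTheory.LFunctions

/-! ### §1 The location law on `ℤ*` and polynomial majorants -/

/-- `log₊ x ≤ 2 + |x|` (indeed `log(2 + |x|) ≤ 1 + |x|`). [folklore] -/
private theorem logPlus_le_two_add_abs (x : ℝ) : logPlus x ≤ 2 + |x| := by
  rw [logPlus_eq]
  have := Real.log_le_sub_one_of_pos (by positivity : (0 : ℝ) < 2 + |x|)
  linarith

/-- The location law (50) on all of `ℤ` from its `ℕ`-indexed form at a time `t` (oddness of
`x_j`, `ξ_j`, evenness of `log₊`; `j = 0` is trivial), with the non-negative constant `max B 0`.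
[cite: RodgersTaoFMP2020, Corollary 10 (50) = v4 Corollary 3.3 (50) p. 23] -/
theorem abs_deBruijnZeroZ_sub_classicalLocationZ_le {t B : ℝ}
    (h50 : ∀ n : ℕ, 1 ≤ n →
      |deBruijnZero t n - classicalLocation (n : ℝ)| ≤ B * logPlus (classicalLocation (n : ℝ)))
    (j : ℤ) :
    |deBruijnZeroZ t j - classicalLocationZ j| ≤ max B 0 * logPlus (classicalLocationZ j) := by
  have key : ∀ j : ℤ, 0 < j →
      |deBruijnZeroZ t j - classicalLocationZ j| ≤ max B 0 * logPlus (classicalLocationZ j) := by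
    intro j hj
    rw [classicalLocationZ_of_pos hj]
    exact (location_int_of_nat h50 (show 1 ≤ j by omega)).trans
      (mul_le_mul_of_nonneg_right (le_max_left _ _) (logPlus_nonneg _))
  rcases lt_trichotomy j 0 with hj | rfl | hj
  · have h := key (-j) (by omega)
    rw [deBruijnZeroZ_neg, classicalLocationZ_neg, logPlus_neg, ← abs_neg] at h
    convert h using 2; ring
  · simp only [deBruijnZeroZ_zero, classicalLocationZ_zero, sub_zero, abs_zero]
    exact mul_nonneg (le_max_right _ _) (logPlus_nonneg _)
  · exact key j hj

/-- The uniform polynomial majorants for the renormalised Hamiltonian and for the linear term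
`D_{jk} = ((x_j − ξ_j) − (x_k − ξ_k))/(ξ_j − ξ_k)` on a window `[t₁, t₂]` above a real-rooted time,
under the location law (50): there is `K ≥ 0` with `|D_{jk}(t)| ≤ K (2+|j|)³(2+|k|)³` and
`0 ≤ H̃_{jk}(t) ≤ K (2+|j|)³(2+|k|)³` for all `t ∈ [t₁,t₂]` and distinct `j, k ∈ ℤ*` (inputs: the
gap bound `rodgers_tao_gap_bound_of` = Prop. 13 in RH-free form, (44), (43), (63)/(71)).
[cite: RodgersTaoFMP2020, §7 p. 44 (proof of Lemma 19: «the sum here is absolutely convergent»)] -/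
theorem exists_renormHamiltonianZ_poly_bound {t₀ t₁ t₂ B : ℝ} (h01 : t₀ < t₁)
    (hreal : HasOnlyRealZeros (deBruijnH t₀))
    (h50 : ∀ t ∈ Icc t₁ t₂, ∀ n : ℕ, 1 ≤ n →
      |deBruijnZero t n - classicalLocation (n : ℝ)| ≤ B * logPlus (classicalLocation (n : ℝ))) :
    ∃ K : ℝ, 0 ≤ K ∧ ∀ t ∈ Icc t₁ t₂, ∀ j k : ℤ, j ≠ 0 → k ≠ 0 → j ≠ k →
      |(deBruijnZeroZ t j - classicalLocationZ j) / (classicalLocationZ j - classicalLocationZ k)| ≤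
        K * ((2 + |(j : ℝ)|) ^ 3 * (2 + |(k : ℝ)|) ^ 3) ∧
      |((deBruijnZeroZ t j - classicalLocationZ j) - (deBruijnZeroZ t k - classicalLocationZ k)) /
          (classicalLocationZ j - classicalLocationZ k)| ≤
        K * ((2 + |(j : ℝ)|) ^ 3 * (2 + |(k : ℝ)|) ^ 3) ∧
      0 ≤ renormHamiltonianZ t j k ∧
      renormHamiltonianZ t j k ≤ K * ((2 + |(j : ℝ)|) ^ 3 * (2 + |(k : ℝ)|) ^ 3) := by
  obtain ⟨A, hA⟩ := rodgers_tao_gap_bound_of h01 hreal h50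
  obtain ⟨Cξ, hCξ, hinv⟩ := exists_inv_abs_sub_classicalLocationZ_le
  obtain ⟨CL, hCL1, hlogξ⟩ := exists_logPlus_classicalLocationZ_le
  obtain ⟨Bξ, hBξ, habsξ⟩ := exists_abs_classicalLocationZ_le
  set B' : ℝ := max B 0 with hB'
  set A' : ℝ := max A 0 with hA'
  have hB'0 : 0 ≤ B' := le_max_right _ _
  have hA'0 : 0 ≤ A' := le_max_right _ _
  have hCL0 : 0 ≤ CL := by linarith
  refine ⟨Bξ + 2 * A' + B' * CL * Cξ, by positivity, fun t ht j k hj hk hjk ↦ ?_⟩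
  have hΛ : ∃ t' : ℝ, t' < t ∧ HasOnlyRealZeros (deBruijnH t') := ⟨t₀, by linarith [ht.1], hreal⟩
  set aj : ℝ := 2 + |(j : ℝ)| with haj
  set ak : ℝ := 2 + |(k : ℝ)| with hak
  have haj2 : 2 ≤ aj := by rw [haj]; linarith [abs_nonneg (j : ℝ)]
  have hak2 : 2 ≤ ak := by rw [hak]; linarith [abs_nonneg (k : ℝ)]
  have hW1 : 1 ≤ aj ^ 3 * ak ^ 3 := one_le_mul_of_one_le_of_one_le (one_le_pow₀ (by linarith))
    (one_le_pow₀ (by linarith))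
  -- log₊ bounds
  have hLj : logPlus (j : ℝ) ≤ aj := logPlus_le_two_add_abs _
  have hLk : logPlus (k : ℝ) ≤ ak := logPlus_le_two_add_abs _
  -- the location deviations
  have hdj : |deBruijnZeroZ t j - classicalLocationZ j| ≤ B' * CL * aj := by
    calc |deBruijnZeroZ t j - classicalLocationZ j| ≤ B' * logPlus (classicalLocationZ j) :=
          abs_deBruijnZeroZ_sub_classicalLocationZ_le (h50 t ht) j
      _ ≤ B' * (CL * aj) := mul_le_mul_of_nonneg_left ((hlogξ j).trans
          (mul_le_mul_of_nonneg_left hLj hCL0)) hB'0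
      _ = B' * CL * aj := by ring
  have hdk : |deBruijnZeroZ t k - classicalLocationZ k| ≤ B' * CL * ak := by
    calc |deBruijnZeroZ t k - classicalLocationZ k| ≤ B' * logPlus (classicalLocationZ k) :=
          abs_deBruijnZeroZ_sub_classicalLocationZ_le (h50 t ht) k
      _ ≤ B' * (CL * ak) := mul_le_mul_of_nonneg_left ((hlogξ k).trans
          (mul_le_mul_of_nonneg_left hLk hCL0)) hB'0
      _ = B' * CL * ak := by ring
  -- 1/|Δξ| ≤ Cξ aj ak
  have hd1 : 1 ≤ |(j : ℝ) - k| := by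
    have h1 : (1 : ℤ) ≤ |j - k| := Int.one_le_abs (sub_ne_zero.2 hjk)
    have h2 : ((1 : ℤ) : ℝ) ≤ ((|j - k| : ℤ) : ℝ) := by exact_mod_cast h1
    rw [Int.cast_abs, Int.cast_sub] at h2
    simpa using h2
  have hinv' : 1 / |classicalLocationZ j - classicalLocationZ k| ≤ Cξ * (aj * ak) := by
    refine (hinv j k hj hk).trans ?_
    have h1 : logPlus (|(j : ℝ)| + |(k : ℝ)|) ≤ aj * ak := by
      have h0 : (0 : ℝ) ≤ |(j : ℝ)| + |(k : ℝ)| := by positivity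
      have := logPlus_le_two_add_abs (|(j : ℝ)| + |(k : ℝ)|)
      rw [abs_of_nonneg h0] at this
      nlinarith [abs_nonneg (j : ℝ), abs_nonneg (k : ℝ)]
    calc Cξ * (logPlus (|(j : ℝ)| + |(k : ℝ)|) / |(j : ℝ) - k|)
        ≤ Cξ * (logPlus (|(j : ℝ)| + |(k : ℝ)|) / 1) := by
          refine mul_le_mul_of_nonneg_left ?_ hCξ.le
          exact div_le_div_of_nonneg_left (logPlus_nonneg _) one_pos hd1
      _ ≤ Cξ * (aj * ak) := by rw [div_one]; exact mul_le_mul_of_nonneg_left h1 hCξ.le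
  -- |D| ≤ B' CL Cξ aj² ak² ≤ K W
  have hξne : classicalLocationZ j - classicalLocationZ k ≠ 0 := classicalLocationZ_sub_ne_zero hjk.symm
  have hD : |((deBruijnZeroZ t j - classicalLocationZ j) - (deBruijnZeroZ t k - classicalLocationZ k)) /
      (classicalLocationZ j - classicalLocationZ k)| ≤ B' * CL * Cξ * (aj ^ 2 * ak ^ 2) := by
    rw [abs_div]
    have hnum : |(deBruijnZeroZ t j - classicalLocationZ j) - (deBruijnZeroZ t k - classicalLocationZ k)|
        ≤ B' * CL * (aj * ak) := by
      calc _ ≤ |deBruijnZeroZ t j - classicalLocationZ j| + |deBruijnZeroZ t k - classicalLocationZ k| :=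
            abs_sub _ _
        _ ≤ B' * CL * aj + B' * CL * ak := add_le_add hdj hdk
        _ = B' * CL * (aj + ak) := by ring
        _ ≤ B' * CL * (aj * ak) := by
            refine mul_le_mul_of_nonneg_left ?_ (by positivity)
            nlinarith
    have hden : 0 < |classicalLocationZ j - classicalLocationZ k| := abs_pos.2 hξne
    rw [div_eq_mul_one_div]
    calc |deBruijnZeroZ t j - classicalLocationZ j - (deBruijnZeroZ t k - classicalLocationZ k)| *
          (1 / |classicalLocationZ j - classicalLocationZ k|)
        ≤ B' * CL * (aj * ak) * (Cξ * (aj * ak)) :=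
          mul_le_mul hnum hinv' (by positivity) (by positivity)
      _ = B' * CL * Cξ * (aj ^ 2 * ak ^ 2) := by ring
  have hW23 : aj ^ 2 * ak ^ 2 ≤ aj ^ 3 * ak ^ 3 := by
    have h1 : aj ^ 2 ≤ aj ^ 3 := pow_le_pow_right₀ (by linarith) (by norm_num)
    have h2 : ak ^ 2 ≤ ak ^ 3 := pow_le_pow_right₀ (by linarith) (by norm_num)
    exact mul_le_mul h1 h2 (by positivity) (by positivity)
  have hD' : |((deBruijnZeroZ t j - classicalLocationZ j) - (deBruijnZeroZ t k - classicalLocationZ k)) /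
      (classicalLocationZ j - classicalLocationZ k)| ≤ B' * CL * Cξ * (aj ^ 3 * ak ^ 3) :=
    hD.trans (mul_le_mul_of_nonneg_left hW23 (by positivity))
  have hsingle : |(deBruijnZeroZ t j - classicalLocationZ j) / (classicalLocationZ j - classicalLocationZ k)|
      ≤ B' * CL * Cξ * (aj ^ 3 * ak ^ 3) := by
    rw [abs_div, div_eq_mul_one_div]
    calc |deBruijnZeroZ t j - classicalLocationZ j| * (1 / |classicalLocationZ j - classicalLocationZ k|)
        ≤ B' * CL * aj * (Cξ * (aj * ak)) := mul_le_mul hdj hinv' (by positivity) (by positivity)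
      _ = B' * CL * Cξ * (aj ^ 2 * ak) := by ring
      _ ≤ B' * CL * Cξ * (aj ^ 3 * ak ^ 3) := by
          refine mul_le_mul_of_nonneg_left ?_ (by positivity)
          have h1 : aj ^ 2 ≤ aj ^ 3 := pow_le_pow_right₀ (by linarith) (by norm_num)
          have h2 : ak ≤ ak ^ 3 := le_self_pow₀ (by linarith) (by norm_num)
          exact mul_le_mul h1 h2 (by positivity) (by positivity)
  have hKle : B' * CL * Cξ ≤ Bξ + 2 * A' + B' * CL * Cξ := by linarith [mul_nonneg hA'0 one_pos.le]
  refine ⟨hsingle.trans (mul_le_mul_of_nonneg_right hKle (by positivity)),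
    hD'.trans (mul_le_mul_of_nonneg_right hKle (by positivity)),
    renormHamiltonianZ_nonneg_of_strictMono (strictMono_deBruijnZeroZ hΛ) hjk, ?_⟩
  -- H̃ = H + log|Δξ| + D
  rw [renormHamiltonianZ_eq_hamiltonianInteraction_sub hΛ hjk, one_div, Real.log_inv, sub_neg_eq_add]
  -- H ≤ A' log₊² j log₊ log₊ j ≤ 2 A' aj³
  have hH : hamiltonianInteraction t j k ≤ 2 * A' * aj ^ 3 := by
    have h1 := hA t ht j k hj hk hjk.symm
    have hll : logPlus (logPlus (j : ℝ)) ≤ 2 * aj := by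
      have := logPlus_le_two_add_abs (logPlus (j : ℝ))
      rw [abs_of_nonneg (logPlus_nonneg _)] at this
      linarith
    have h2 : logPlus (j : ℝ) ^ 2 * logPlus (logPlus (j : ℝ)) ≤ aj ^ 2 * (2 * aj) :=
      mul_le_mul (pow_le_pow_left₀ (logPlus_nonneg _) hLj 2) hll (logPlus_nonneg _) (by positivity)
    calc hamiltonianInteraction t j k ≤ A * (logPlus (j : ℝ) ^ 2 * logPlus (logPlus (j : ℝ))) := h1
      _ ≤ A' * (logPlus (j : ℝ) ^ 2 * logPlus (logPlus (j : ℝ))) :=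
          mul_le_mul_of_nonneg_right (le_max_left _ _)
            (mul_nonneg (sq_nonneg _) (logPlus_nonneg _))
      _ ≤ A' * (aj ^ 2 * (2 * aj)) := mul_le_mul_of_nonneg_left h2 hA'0
      _ = 2 * A' * aj ^ 3 := by ring
  -- log|Δξ| ≤ Bξ aj ak
  have hlogξ' : Real.log |classicalLocationZ j - classicalLocationZ k| ≤ Bξ * (aj * ak) := by
    have hpos : 0 < |classicalLocationZ j - classicalLocationZ k| := abs_pos.2 hξne
    have h1 : |classicalLocationZ j - classicalLocationZ k| ≤ Bξ * (aj * ak) := by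
      calc _ ≤ |classicalLocationZ j| + |classicalLocationZ k| := abs_sub _ _
        _ ≤ Bξ * |(j : ℝ)| + Bξ * |(k : ℝ)| := add_le_add (habsξ j) (habsξ k)
        _ = Bξ * (|(j : ℝ)| + |(k : ℝ)|) := by ring
        _ ≤ Bξ * (aj * ak) := by
            refine mul_le_mul_of_nonneg_left ?_ hBξ.le
            nlinarith [abs_nonneg (j : ℝ), abs_nonneg (k : ℝ)]
    have := Real.log_le_sub_one_of_pos hpos
    linarith
  have haj3 : aj * ak ≤ aj ^ 3 * ak ^ 3 := by
    have h1 : aj ≤ aj ^ 3 := le_self_pow₀ (by linarith) (by norm_num)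
    have h2 : ak ≤ ak ^ 3 := le_self_pow₀ (by linarith) (by norm_num)
    exact mul_le_mul h1 h2 (by positivity) (by positivity)
  have haj3' : aj ^ 3 ≤ aj ^ 3 * ak ^ 3 :=
    le_mul_of_one_le_right (by positivity) (one_le_pow₀ (by linarith))
  have hDle := (le_abs_self _).trans hD'
  calc hamiltonianInteraction t j k + Real.log |classicalLocationZ j - classicalLocationZ k| +
        ((deBruijnZeroZ t j - classicalLocationZ j) - (deBruijnZeroZ t k - classicalLocationZ k)) /
          (classicalLocationZ j - classicalLocationZ k)
      ≤ 2 * A' * aj ^ 3 + Bξ * (aj * ak) + B' * CL * Cξ * (aj ^ 3 * ak ^ 3) := by linarith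
    _ ≤ 2 * A' * (aj ^ 3 * ak ^ 3) + Bξ * (aj ^ 3 * ak ^ 3) + B' * CL * Cξ * (aj ^ 3 * ak ^ 3) := by
        have e1 := mul_le_mul_of_nonneg_left haj3' (by positivity : 0 ≤ 2 * A')
        have e2 := mul_le_mul_of_nonneg_left haj3 hBξ.le
        linarith
    _ = (Bξ + 2 * A' + B' * CL * Cξ) * (aj ^ 3 * ak ^ 3) := by ring

/-- The polynomially weighted `ψ_T` is summable on `ℤ`: `Σ_j ψ_T(j)(2+|j|)³ < ∞` (for `T log T ≥ 1`;
`ψ_T(j)(2+|j|)³ ≤ (2+N)³(1+|j|/N)^{−2} ≤ (2+N)³N²/j²`). [cite: RodgersTaoFMP2020, §7 p. 42 (66)] -/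
theorem summable_truncWeight_mul_cube {T : ℝ} (hT : 1 ≤ T * Real.log T) :
    Summable (fun j : ℤ ↦ truncWeight T j * (2 + |(j : ℝ)|) ^ 3) := by
  set N := T * Real.log T with hN
  have hN0 : 0 < N := by linarith
  -- majorant m j := (2+N)^3 N^2 (|j|^{-2} + 1_{j=0})
  set m : ℤ → ℝ := fun j ↦ (2 + N) ^ 3 * N ^ 2 * (|(j : ℝ)| ^ (-(2 : ℝ)) + if j = 0 then 1 else 0)
    with hm
  have hs1 : Summable (fun j : ℤ ↦ |(j : ℝ)| ^ (-(2 : ℝ))) := Real.summable_abs_int_rpow one_lt_two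
  have hs2 : Summable (fun j : ℤ ↦ (if j = 0 then (1 : ℝ) else 0)) := by
    refine summable_of_ne_finset_zero (s := {0}) fun j hj ↦ ?_
    rw [Finset.mem_singleton] at hj; simp [hj]
  have hsm : Summable m := (hs1.add hs2).mul_left _
  refine Summable.of_nonneg_of_le (fun j ↦ mul_nonneg (truncWeight_pos hN0 j).le (by positivity))
    (fun j ↦ ?_) hsm
  -- pointwise
  have hu0 : 0 ≤ |(j : ℝ)| / N := by positivity
  have hprof := truncWeight_le_profile_sq hN0 j
  have h1 : (2 + |(j : ℝ)|) ^ 3 ≤ (2 + N) ^ 3 * (1 + |(j : ℝ)| / N) ^ 3 := by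
    rw [← mul_pow]
    refine pow_le_pow_left₀ (by positivity) ?_ 3
    have : (2 + N) * (1 + |(j : ℝ)| / N) = 2 + N + 2 * (|(j : ℝ)| / N) + |(j : ℝ)| := by
      field_simp; ring
    rw [this]; linarith [mul_nonneg (show (0:ℝ) ≤ 2 by norm_num) hu0]
  have h2 : truncWeight T j * (2 + |(j : ℝ)|) ^ 3 ≤ (2 + N) ^ 3 * ((1 + |(j : ℝ)| / N) ^ 2)⁻¹ := by
    rw [truncWeight_eq, ← hN]
    have h1u : 1 ≤ 1 + |(j : ℝ)| / N := by linarith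
    calc ((1 + |(j : ℝ)| / N) ^ 100)⁻¹ * (2 + |(j : ℝ)|) ^ 3
        ≤ ((1 + |(j : ℝ)| / N) ^ 100)⁻¹ * ((2 + N) ^ 3 * (1 + |(j : ℝ)| / N) ^ 3) :=
          mul_le_mul_of_nonneg_left h1 (by positivity)
      _ = (2 + N) ^ 3 * (((1 + |(j : ℝ)| / N) ^ 97)⁻¹) := by
          rw [show (1 + |(j : ℝ)| / N) ^ 100 = (1 + |(j : ℝ)| / N) ^ 97 * (1 + |(j : ℝ)| / N) ^ 3 by ring]
          field_simp
      _ ≤ (2 + N) ^ 3 * ((1 + |(j : ℝ)| / N) ^ 2)⁻¹ := by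
          refine mul_le_mul_of_nonneg_left ?_ (by positivity)
          exact inv_anti₀ (by positivity) (pow_le_pow_right₀ h1u (by norm_num))
  refine h2.trans ?_
  simp only [hm]
  rw [mul_assoc ((2 + N) ^ 3)]
  refine mul_le_mul_of_nonneg_left ?_ (by positivity)
  -- (1+|j|/N)^{-2} ≤ N² (|j|^{-2} + 1_{j=0})
  rcases eq_or_ne j 0 with rfl | hj
  · simp only [Int.cast_zero, abs_zero, zero_div, add_zero, one_pow, inv_one, if_true]
    have : (0 : ℝ) ^ (-(2 : ℝ)) = 0 := Real.zero_rpow (by norm_num)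
    rw [this, zero_add, mul_one]
    nlinarith
  · rw [if_neg hj, add_zero]
    have hj0 : 0 < |(j : ℝ)| := abs_pos.2 (by exact_mod_cast hj)
    have e : |(j : ℝ)| ^ (-(2 : ℝ)) = (|(j : ℝ)| ^ 2)⁻¹ := by
      rw [Real.rpow_neg hj0.le, Real.rpow_two]
    rw [e]
    have h3 : |(j : ℝ)| / N ≤ 1 + |(j : ℝ)| / N := by linarith
    calc ((1 + |(j : ℝ)| / N) ^ 2)⁻¹ ≤ ((|(j : ℝ)| / N) ^ 2)⁻¹ :=
          inv_anti₀ (by positivity) (pow_le_pow_left₀ hu0 h3 2)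
      _ = N ^ 2 * (|(j : ℝ)| ^ 2)⁻¹ := by rw [div_pow]; field_simp

/-- The identity behind Lemma 19 on a nearby pair, weighted: for `t` above a real-rooted time and
`p = (j,k) ∈ nearbyPairs T`,
`ψψ H̃_{jk}(t) = ψψ(H_{jk}(t) − log(1/|ξ_j − ξ_k|)) + ψψ D_{jk}(t)` (the first term on the right is
the summand `truncHamiltonianTerm T t p` of (69)). [cite: RodgersTaoFMP2020, Lemma 19 p. 44 (proof, first display)] -/
theorem truncWeight_mul_renormHamiltonianZ_eq {T t : ℝ}
    (hΛ : ∃ t₁ : ℝ, t₁ < t ∧ HasOnlyRealZeros (deBruijnH t₁)) (p : nearbyPairs T) :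
    truncWeight T p.1.1 * truncWeight T p.1.2 * renormHamiltonianZ t p.1.1 p.1.2 =
      truncHamiltonianTerm T t p + truncWeight T p.1.1 * truncWeight T p.1.2 *
        (((deBruijnZeroZ t p.1.1 - classicalLocationZ p.1.1) -
          (deBruijnZeroZ t p.1.2 - classicalLocationZ p.1.2)) /
          (classicalLocationZ p.1.1 - classicalLocationZ p.1.2)) := by
  have hjk : p.1.1 ≠ p.1.2 := (mem_nearbyPairs.1 p.2).2.2.ne
  rw [truncHamiltonianTerm_eq, renormHamiltonianZ_eq_hamiltonianInteraction_sub hΛ hjk]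
  ring


/-! ### §2 Desymmetrization of the error sum -/

/-- Factorisation of the first desymmetrised summand over the row term:
`1[(j,k) nearby] ψ(j)ψ(k) a_j/(ξ_j − ξ_k) = ψ(j) a_j · 1[(j,k) nearby] ψ(k)/(ξ_j − ξ_k)`.
[cite: RodgersTaoFMP2020, §7 p. 44 (proof of Lemma 19, «Desymmetrizing»)] -/
theorem nearby_indicator_factor (T : ℝ) (a : ℤ → ℝ) (j k : ℤ) :
    (nearbyPairs T).indicator (fun p : ℤ × ℤ ↦ truncWeight T p.1 * truncWeight T p.2 *
        (a p.1 / (classicalLocationZ p.1 - classicalLocationZ p.2))) (j, k) =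
      truncWeight T j * a j * (nearbyPairs T).indicator
        (fun p : ℤ × ℤ ↦ truncWeight T p.2 / (classicalLocationZ p.1 - classicalLocationZ p.2)) (j, k) := by
  by_cases h : (j, k) ∈ nearbyPairs T
  · rw [Set.indicator_of_mem h, nearbyRow_eq_of_mem h]; ring
  · rw [Set.indicator_of_notMem h, nearbyRow_eq_zero h, mul_zero]

/-- Antisymmetry under the swap `(j,k) ↦ (k,j)` of the second desymmetrised summand:
`1[(j,k) nearby] ψψ a_k/(ξ_j − ξ_k) = −(1[(k,j) nearby] ψψ a_k/(ξ_k − ξ_j))` (`∼_T` symmetric).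
[cite: RodgersTaoFMP2020, §7 p. 44 (proof of Lemma 19, «Desymmetrizing»)] -/
theorem nearby_indicator_swap (T : ℝ) (a : ℤ → ℝ) (j k : ℤ) :
    (nearbyPairs T).indicator (fun p : ℤ × ℤ ↦ truncWeight T p.1 * truncWeight T p.2 *
        (a p.2 / (classicalLocationZ p.1 - classicalLocationZ p.2))) (j, k) =
      -(nearbyPairs T).indicator (fun p : ℤ × ℤ ↦ truncWeight T p.1 * truncWeight T p.2 *
        (a p.1 / (classicalLocationZ p.1 - classicalLocationZ p.2))) (k, j) := by
  have hiff : (j, k) ∈ nearbyPairs T ↔ (k, j) ∈ nearbyPairs T := by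
    simp only [mem_nearbyPairs]
    exact ⟨fun ⟨h1, h2, h3⟩ ↦ ⟨h2, h1, h3.symm⟩, fun ⟨h1, h2, h3⟩ ↦ ⟨h2, h1, h3.symm⟩⟩
  by_cases h : (j, k) ∈ nearbyPairs T
  · rw [Set.indicator_of_mem h, Set.indicator_of_mem (hiff.1 h)]
    dsimp only
    rw [← neg_sub (classicalLocationZ j) (classicalLocationZ k), div_neg]
    ring
  · rw [Set.indicator_of_notMem h, Set.indicator_of_notMem (fun h' ↦ h (hiff.2 h')), neg_zero]

/-! ### §3 Assembly: the schema form of Lemma 19 -/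

/-- `1 ≤ log T` and `1 ≤ T log T` for `T ≥ 3`. [folklore] -/
private theorem one_le_log_of_three_le {T : ℝ} (hT : 3 ≤ T) : 1 ≤ Real.log T ∧ 1 ≤ T * Real.log T := by
  have hlogT : 1 ≤ Real.log T := by
    rw [← Real.log_exp 1]
    refine Real.log_le_log (Real.exp_pos 1) ?_
    have := Real.exp_one_lt_d9; linarith
  exact ⟨hlogT, by nlinarith⟩

/-- **Rodgers–Tao 2020, Lemma 19 — RH-FREE CONTENT twin (schema form).** On a time window
`[t₁, t₂]` above a real-rooted time `t₀ < t₁`, under the location law (50) in the shape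
`|x_n(t) − ξ_n| ≤ B log₊ ξ_n` (`n ≥ 1`; the hypotheses H1/H2 of the cell's P5.1/P6.1 twins), for
every `ε > 0` there is `T₁` such that for all `T ≥ T₁` and all `t ∈ [t₁, t₂]`: the series (69)
defining `H̃_T(t)` and the series `Σ_{j∼_T k} ψ_T(j)ψ_T(k) H̃_{jk}(t)` are absolutely convergent, and
`|H̃_T(t) − Σ_{j∼_T k} ψ_T(j)ψ_T(k) H̃_{jk}(t)| ≤ ε · T log³ T`
(the printed `o_{T→∞}(T log³₊ T)`, decay rate uniform in `t`). Road (the printed one):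
`H̃_{jk} = H_{jk} − log(1/|ξ_j − ξ_k|) + D_{jk}` (identity of p. 44, tree:
`renormHamiltonianZ_eq_hamiltonianInteraction_sub`), absolute convergence from the gap bound
(Prop. 13 in RH-free form, `rodgers_tao_gap_bound_of`) and (44), desymmetrisation
`Σ ψψ D_{jk} = 2 Σ_j ψ_T(j)(x_j − ξ_j) S_j(T)` (Fubini + the swap `(j,k) ↦ (k,j)`), and the
`t`-free core `nearbyRow_weighted_tsum_le` of Part I. What this shows about the printed fact
`rodgers_tao_truncHamiltonian_expansion` (typed range `Λ/2 ≤ t ≤ 0` under `Λ < 0`,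
VACUOUS-AS-PRINTED): its mathematical content holds on every window where its inputs (location law,
real zeros) hold — see `rodgers_tao_truncHamiltonian_expansion_of_cor33_location` for the
as-printed reduction. [cite: RodgersTaoFMP2020, Lemma 19 p. 44 (= arXiv:1801.05914v4 Lemma 7.4)] -/
theorem rodgers_tao_truncHamiltonian_expansion_of {t₀ t₁ t₂ B : ℝ} (h01 : t₀ < t₁)
    (hreal : HasOnlyRealZeros (deBruijnH t₀))
    (h50 : ∀ t ∈ Icc t₁ t₂, ∀ n : ℕ, 1 ≤ n →
      |deBruijnZero t n - classicalLocation (n : ℝ)| ≤ B * logPlus (classicalLocation (n : ℝ))) :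
    ∀ ε : ℝ, 0 < ε → ∃ T₁ : ℝ, ∀ T : ℝ, T₁ ≤ T → ∀ t ∈ Icc t₁ t₂,
      Summable (truncHamiltonianTerm T t) ∧
      Summable (fun p : nearbyPairs T ↦
        truncWeight T p.1.1 * truncWeight T p.1.2 * renormHamiltonianZ t p.1.1 p.1.2) ∧
      |truncHamiltonian T t - ∑' p : nearbyPairs T,
          truncWeight T p.1.1 * truncWeight T p.1.2 * renormHamiltonianZ t p.1.1 p.1.2|
        ≤ ε * (T * Real.log T ^ 3) := by
  intro ε hε
  obtain ⟨K, hK0, hKb⟩ := exists_renormHamiltonianZ_poly_bound h01 hreal h50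
  set B' : ℝ := max B 0 with hB'
  have hB'0 : 0 ≤ B' := le_max_right _ _
  have hε' : 0 < ε / (2 * B' + 2) := by positivity
  obtain ⟨T₁, hT₁16, hcore⟩ := nearbyRow_weighted_tsum_le (ε / (2 * B' + 2)) hε'
  refine ⟨T₁, fun T hT t ht ↦ ?_⟩
  have hT3 : 3 ≤ T := by linarith
  have hT0 : 0 < T := by linarith
  obtain ⟨hlogT, hTL1⟩ := one_le_log_of_three_le hT3
  have hTL0 : 0 < T * Real.log T := by linarith
  have hΛ : ∃ t' : ℝ, t' < t ∧ HasOnlyRealZeros (deBruijnH t') := ⟨t₀, by linarith [ht.1], hreal⟩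
  obtain ⟨hsrow, hrowle⟩ := hcore T hT
  -- notation
  set ψ : ℤ → ℝ := fun j ↦ truncWeight T j with hψ
  set a : ℤ → ℝ := fun j ↦ deBruijnZeroZ t j - classicalLocationZ j with ha
  set Mj : ℤ → ℝ := fun j ↦ truncWeight T j * (2 + |(j : ℝ)|) ^ 3 with hMj
  set G : nearbyPairs T → ℝ := fun p ↦
    truncWeight T p.1.1 * truncWeight T p.1.2 * renormHamiltonianZ t p.1.1 p.1.2 with hG
  set Dw : nearbyPairs T → ℝ := fun p ↦ truncWeight T p.1.1 * truncWeight T p.1.2 *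
    ((a p.1.1 - a p.1.2) / (classicalLocationZ p.1.1 - classicalLocationZ p.1.2)) with hDw
  have hψ0 : ∀ j, 0 ≤ ψ j := fun j ↦ (truncWeight_pos hTL0 j).le
  have hMj0 : ∀ j, 0 ≤ Mj j := fun j ↦ mul_nonneg (hψ0 j) (by positivity)
  -- the majorant on ℤ × ℤ
  have hsMj : Summable Mj := summable_truncWeight_mul_cube hTL1
  have hMaj : Summable (fun q : ℤ × ℤ ↦ K * (Mj q.1 * Mj q.2)) :=
    (hsMj.mul_of_nonneg hsMj hMj0 hMj0).mul_left K
  have hMajW : ∀ j k : ℤ, K * (Mj j * Mj k) =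
      ψ j * ψ k * (K * ((2 + |(j : ℝ)|) ^ 3 * (2 + |(k : ℝ)|) ^ 3)) := by
    intro j k; simp only [hMj, hψ]; ring
  -- pointwise bounds on the nearby pairs
  have hmemP : ∀ p : nearbyPairs T, p.1.1 ≠ 0 ∧ p.1.2 ≠ 0 ∧ p.1.1 ≠ p.1.2 := fun p ↦
    ⟨(mem_nearbyPairs.1 p.2).1, (mem_nearbyPairs.1 p.2).2.1, (mem_nearbyPairs.1 p.2).2.2.ne⟩
  have hGb : ∀ p : nearbyPairs T, 0 ≤ G p ∧ G p ≤ K * (Mj p.1.1 * Mj p.1.2) := by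
    intro p
    obtain ⟨hj, hk, hjk⟩ := hmemP p
    obtain ⟨-, -, hH0, hHle⟩ := hKb t ht p.1.1 p.1.2 hj hk hjk
    have hw : 0 ≤ ψ p.1.1 * ψ p.1.2 := mul_nonneg (hψ0 _) (hψ0 _)
    refine ⟨mul_nonneg hw hH0, ?_⟩
    rw [hMajW]
    exact mul_le_mul_of_nonneg_left hHle hw
  have hDb : ∀ p : nearbyPairs T, |Dw p| ≤ K * (Mj p.1.1 * Mj p.1.2) := by
    intro p
    obtain ⟨hj, hk, hjk⟩ := hmemP p
    obtain ⟨-, hD, -, -⟩ := hKb t ht p.1.1 p.1.2 hj hk hjk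
    have hw : 0 ≤ ψ p.1.1 * ψ p.1.2 := mul_nonneg (hψ0 _) (hψ0 _)
    rw [hMajW]
    simp only [hDw, ha]
    rw [abs_mul, abs_of_nonneg hw]
    exact mul_le_mul_of_nonneg_left hD hw
  -- (S2) and the summability of the linear term
  have hMajsub : Summable (fun p : nearbyPairs T ↦ K * (Mj p.1.1 * Mj p.1.2)) :=
    hMaj.subtype (nearbyPairs T)
  have hS2 : Summable G := Summable.of_nonneg_of_le (fun p ↦ (hGb p).1) (fun p ↦ (hGb p).2) hMajsub
  have hSD : Summable Dw :=
    summable_abs_iff.1 (Summable.of_nonneg_of_le (fun p ↦ abs_nonneg _) hDb hMajsub)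
  -- (S1): the summand of (69) is G − Dw
  have hident : ∀ p : nearbyPairs T, truncHamiltonianTerm T t p = G p - Dw p := by
    intro p
    have := truncWeight_mul_renormHamiltonianZ_eq (T := T) hΛ p
    simp only [hG, hDw, ha]
    linarith
  have hS1 : Summable (truncHamiltonianTerm T t) := by
    have h := hS2.sub hSD
    exact h.congr fun p ↦ (hident p).symm
  refine ⟨hS1, hS2, ?_⟩
  -- the difference is −Σ Dw
  have hdiff : truncHamiltonian T t - ∑' p : nearbyPairs T, G p = -∑' p : nearbyPairs T, Dw p := by
    rw [truncHamiltonian_eq, show (∑' p : nearbyPairs T, truncHamiltonianTerm T t p) =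
      ∑' p : nearbyPairs T, (G p - Dw p) from tsum_congr hident, hS2.tsum_sub hSD]
    ring
  rw [hdiff, abs_neg]
  -- pass to ℤ × ℤ with the indicator, and desymmetrize
  set g₁ : ℤ × ℤ → ℝ := fun q ↦ truncWeight T q.1 * truncWeight T q.2 *
    (a q.1 / (classicalLocationZ q.1 - classicalLocationZ q.2)) with hg₁
  set g₂ : ℤ × ℤ → ℝ := fun q ↦ truncWeight T q.1 * truncWeight T q.2 *
    (a q.2 / (classicalLocationZ q.1 - classicalLocationZ q.2)) with hg₂
  set Φ₁ : ℤ × ℤ → ℝ := (nearbyPairs T).indicator g₁ with hΦ₁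
  set Φ₂ : ℤ × ℤ → ℝ := (nearbyPairs T).indicator g₂ with hΦ₂
  have hDw_eq : ∀ p : nearbyPairs T, Dw p = g₁ p.1 - g₂ p.1 := by
    intro p; simp only [hDw, hg₁, hg₂]; ring
  have htsub : ∑' p : nearbyPairs T, Dw p = ∑' q : ℤ × ℤ, (nearbyPairs T).indicator (g₁ - g₂) q := by
    rw [show (∑' p : nearbyPairs T, Dw p) = ∑' p : nearbyPairs T, (g₁ - g₂) p.1 from
      tsum_congr fun p ↦ by rw [hDw_eq]; rfl]
    exact tsum_subtype (nearbyPairs T) (g₁ - g₂)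
  -- summability of Φ₁, Φ₂ on ℤ × ℤ via the majorant
  have hbound₁ : ∀ q : ℤ × ℤ, |Φ₁ q| ≤ K * (Mj q.1 * Mj q.2) := by
    intro q
    by_cases hq : q ∈ nearbyPairs T
    · obtain ⟨hj, hk, hnb⟩ := (mem_nearbyPairs (p := q)).1 hq
      obtain ⟨hs, -, -, -⟩ := hKb t ht q.1 q.2 hj hk hnb.ne
      have hw : 0 ≤ ψ q.1 * ψ q.2 := mul_nonneg (hψ0 _) (hψ0 _)
      simp only [hΦ₁]
      rw [Set.indicator_of_mem hq, hMajW, hg₁]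
      dsimp only
      rw [abs_mul, abs_of_nonneg hw]
      exact mul_le_mul_of_nonneg_left hs hw
    · simp only [hΦ₁]; rw [Set.indicator_of_notMem hq, abs_zero]
      exact mul_nonneg hK0 (mul_nonneg (hMj0 _) (hMj0 _))
  have hΦ₂_swap : ∀ q : ℤ × ℤ, Φ₂ q = -Φ₁ q.swap := by
    intro q
    simp only [hΦ₁, hΦ₂, hg₁, hg₂]
    exact nearby_indicator_swap T a q.1 q.2
  have hsΦ₁ : Summable Φ₁ :=
    summable_abs_iff.1 (Summable.of_nonneg_of_le (fun q ↦ abs_nonneg _) hbound₁ hMaj)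
  have hsΦ₁swap : Summable (fun q : ℤ × ℤ ↦ Φ₁ q.swap) :=
    (Equiv.prodComm ℤ ℤ).summable_iff.2 hsΦ₁
  have hsΦ₂ : Summable Φ₂ := by
    have : Φ₂ = fun q ↦ -Φ₁ q.swap := funext hΦ₂_swap
    rw [this]; exact hsΦ₁swap.neg
  have hind_sub : ∀ q, (nearbyPairs T).indicator (g₁ - g₂) q = Φ₁ q - Φ₂ q := by
    intro q; simp only [hΦ₁, hΦ₂]; rw [Set.indicator_sub']; rfl
  have htsum_Φ₂ : ∑' q, Φ₂ q = -∑' q, Φ₁ q := by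
    rw [show (∑' q, Φ₂ q) = ∑' q : ℤ × ℤ, -Φ₁ q.swap from tsum_congr hΦ₂_swap, tsum_neg]
    congr 1
    exact (Equiv.prodComm ℤ ℤ).tsum_eq Φ₁
  have hsum_eq : ∑' p : nearbyPairs T, Dw p = 2 * ∑' q, Φ₁ q := by
    rw [htsub, show (∑' q, (nearbyPairs T).indicator (g₁ - g₂) q) = ∑' q, (Φ₁ q - Φ₂ q) from
      tsum_congr hind_sub, hsΦ₁.tsum_sub hsΦ₂, htsum_Φ₂]
    ring
  -- Fubini: Σ_q Φ₁ q = Σ_j ψ(j) a_j S_j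
  set S : ℤ → ℝ := fun j ↦ ∑' k : ℤ, (nearbyPairs T).indicator
    (fun p : ℤ × ℤ ↦ truncWeight T p.2 / (classicalLocationZ p.1 - classicalLocationZ p.2)) (j, k) with hS
  have hrow_eq : ∀ j k : ℤ, Φ₁ (j, k) = ψ j * a j * (nearbyPairs T).indicator
      (fun p : ℤ × ℤ ↦ truncWeight T p.2 / (classicalLocationZ p.1 - classicalLocationZ p.2)) (j, k) := by
    intro j k; simp only [hΦ₁, hg₁, hψ]; exact nearby_indicator_factor T a j k
  have hrows : ∀ j : ℤ, Summable fun k : ℤ ↦ Φ₁ (j, k) := by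
    intro j
    simp only [hrow_eq]
    exact (summable_nearbyRow T j).mul_left _
  have hfubini : ∑' q, Φ₁ q = ∑' j : ℤ, ψ j * a j * S j := by
    rw [hsΦ₁.tsum_prod' hrows]
    refine tsum_congr fun j ↦ ?_
    simp only [hrow_eq, hS]
    exact tsum_mul_left
  -- the weighted row estimate
  have hloc : ∀ j : ℤ, |a j| ≤ B' * logPlus (classicalLocationZ j) := fun j ↦
    abs_deBruijnZeroZ_sub_classicalLocationZ_le (h50 t ht) j
  have hmaj_rows : ∀ j : ℤ, ‖ψ j * a j * S j‖ ≤ B' * (truncWeight T j * logPlus (classicalLocationZ j) * |S j|) := by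
    intro j
    rw [Real.norm_eq_abs, abs_mul, abs_mul, abs_of_nonneg (hψ0 j)]
    have := mul_le_mul_of_nonneg_left (hloc j) (hψ0 j)
    calc ψ j * |a j| * |S j| ≤ ψ j * (B' * logPlus (classicalLocationZ j)) * |S j| :=
          mul_le_mul_of_nonneg_right this (abs_nonneg _)
      _ = B' * (truncWeight T j * logPlus (classicalLocationZ j) * |S j|) := by simp only [hψ]; ring
  have hsrows' : Summable (fun j : ℤ ↦ B' * (truncWeight T j * logPlus (classicalLocationZ j) * |S j|)) :=
    hsrow.mul_left B'
  have hfinal : |∑' j : ℤ, ψ j * a j * S j| ≤ B' * (ε / (2 * B' + 2) * (T * Real.log T ^ 3)) := by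
    have h1 : ‖∑' j : ℤ, ψ j * a j * S j‖ ≤ ∑' j : ℤ, B' * (truncWeight T j * logPlus (classicalLocationZ j) * |S j|) :=
      tsum_of_norm_bounded hsrows'.hasSum hmaj_rows
    rw [Real.norm_eq_abs, tsum_mul_left] at h1
    exact h1.trans (mul_le_mul_of_nonneg_left hrowle hB'0)
  -- conclusion
  rw [hsum_eq, hfubini, abs_mul, abs_of_pos (by norm_num : (0 : ℝ) < 2)]
  have hTL3 : 0 ≤ T * Real.log T ^ 3 := by positivity
  calc 2 * |∑' j : ℤ, ψ j * a j * S j| ≤ 2 * (B' * (ε / (2 * B' + 2) * (T * Real.log T ^ 3))) := by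
        linarith
    _ = (2 * B' / (2 * B' + 2)) * ε * (T * Real.log T ^ 3) := by
        field_simp
    _ ≤ 1 * ε * (T * Real.log T ^ 3) := by
        refine mul_le_mul_of_nonneg_right (mul_le_mul_of_nonneg_right ?_ hε.le) hTL3
        rw [div_le_one (by positivity)]; linarith
    _ = ε * (T * Real.log T ^ 3) := by ring

/-- **As-printed reduction** of Lemma 19: the typed Corollary 10 (50) `RodgersTao2020.cor33_location`
(location law for `Λ < t ≤ 0`, witness form) implies the typed Lemma 19
`rodgers_tao_truncHamiltonian_expansion` (witness form, `Λ/2 ≤ t ≤ 0`), by the schema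
`rodgers_tao_truncHamiltonian_expansion_of` on the window `[t₀/2, 0]` above the real-rooted witness
`t₀ < 0`. (Both facts are VACUOUS-AS-PRINTED and already have their ex-falso `_holds`; this records
that the printed implication (50) + Prop. 13 + (44)–(45) ⟹ Lemma 19 is kernel-checked with content.
No second `_holds` is declared.) [cite: RodgersTaoFMP2020, Lemma 19 p. 44 (= arXiv:1801.05914v4 Lemma 7.4)] -/
theorem rodgers_tao_truncHamiltonian_expansion_of_cor33_location (h : RodgersTao2020.cor33_location) :
    rodgers_tao_truncHamiltonian_expansion := by
  intro t₀ ht₀ hreal ε hε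
  obtain ⟨A50, hA50⟩ := h
  obtain ⟨T₁, hT₁⟩ := rodgers_tao_truncHamiltonian_expansion_of (t₁ := t₀ / 2) (t₂ := 0) (B := A50)
    (by linarith) hreal
    (fun t ht n hn ↦ hA50 t ⟨t₀, by linarith [ht.1], hreal⟩ ht.2 n hn) ε hε
  exact ⟨T₁, fun T hT t h1 h2 ↦ hT₁ T hT t ⟨h1, h2⟩⟩

end Literature.NumberTheory.LFunctions

end
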